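import Summits.BirchSwinnertonDyer.BirchSwinnertonDyer.Theorems.SignedBaseChangeAnticyclotomicEisensteinDivisibilityAdmdefUnitLambdaOfLoc
import HarnessLib

/-!
# Line `admdef` on the crux `AnticyclotomicEisensteinDivisibility` (stmt-BirchSwinnertonDyer-20727), LEAD gen 24:
# the CONVERSE root criterion — a UNIT `λ⁺_1(q)` at a definite vertex adjacent to the root makes the base class VISIBLE at `q`
# (so `z_{0,1} ≠ 0`): Howard's core-vertex dichotomy at the root, converse half of `…AdmdefUnitLambdaOfLoc`

Lead seat bsd-line-sbc-p1 (gen 24), `--supports stmt-BirchSwinnertonDyer-20727`.  LEAD g19's `hasUnitLambda_of_root_res_ne_zero` reads the second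
reciprocity law at the bottom layer in the direction «`res_{⟨φ⟩}(κ_1(1)_0) ≠ 0 ⟹ λ_1(q)(0) ∈ ℤ_pˣ`».  THIS FILE proves the converse direction
«`λ_1(q)(0) ∈ ℤ_pˣ ⟹ res_{⟨φ⟩}(κ_1(1)_0) ≠ 0`, hence `κ_1(1)_0 ≠ 0`», GIVEN a non-zero element of the local target `H¹(⟨φ⟩, E[p])`
(for an admissible Frobenius this is the line `E[p]/(φ − 1) ≅ 𝔽_p`; the hypothesis is met, e.g., by the visibility of any non-zero global class
at `φ`, `…AdmdefRootZero`).  Consequence for the registry (v22): the core-root research text (RV₁)H («a p-primitive `+` signed Heegner class with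
its bipartite system has `z_{0,1} ≠ 0` in corank one») FOLLOWS from a rank-0 ANCHOR at ONE definite vertex `{q}` seen by a non-zero Selmer class —
the same research shape as the `d ≥ 3` anchors (memo `Lines/admdef-lead-g24.md`).

* §1 `layer_zero_ne_zero_of_spanEqSmul_of_isUnit` — on a `j = 1` reciprocity line `Λ·x = λ·M` (`SpanEqSmul p 1 λ x M`) over a target killed by
  `p`, a UNIT `λ(0)` and a family `y ∈ M` with `y_0(a) ≠ 0` force `x_0(a) ≠ 0` (the truncated action at layer `0` is multiplication by
  `λ(0) mod p`, `coTsmul_layer_zero_apply`; Bézout).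
* §2 `isCoinducedIn_delta` — the «delta» family `a ↦ [a = 0]·u` is coinduced (`u ⊗ 1 ∈ U ⊗ Λ`), so `M = IsCoinducedIn p ⊤` has a member non-zero at
  layer `0` as soon as `U ≠ 0`.
* §3 `nsmul_torsionH1Over_eq_zero` — `H¹(H, E[n])` is killed by `n` (cocycles with values in `E[n]`).
* §4 **`kappa_one_layer_zero_ne_zero_of_isUnit_lam`** — for a signed bipartite system (`IsSignedBipartiteSystem … N ε B`), a `1`-admissible `q`, a
  Frobenius `φ ∈ D_𝔓 ∩ Gal(K̄/K_∞)` over `q` with `H¹(⟨φ⟩, E[p]) ≠ 0`, and `λ_1(q)(0) ∈ ℤ_pˣ`: `κ_1(1)_0 ≠ 0`; and `limitBaseClass_layer_zero_one_ne_zero_of_isUnit_lam`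
  (the same for the limit base class `z`: `z_{0,1} ≠ 0`).

No definition, no named fact, no `sorry`; standard axioms.  BSD / the crux / (RV₁)H are NOT proved by this file.

## References
* [CastellaEtAl2025] Thm. 7.4, second law; (7.2); Thm. 7.5 (arXiv:2308.10474v2 p. 30 L50–L52, p. 31).
* [Howard2006] B. Howard, *Bipartite Euler systems*, J. reine angew. Math. 597 (2006): Lem. 3.1.2, §3.2 (15)–(16), Thm. 3.2.3 (c), §2.3 (core vertices).
* [BurungaleCastellaKim2021] arXiv:1908.09512 Lem. 7.3, Prop. 7.4.
-/

-- D-0017: single-problem summit, the namespace repeats the problem name by design.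
set_option linter.dupNamespace false
set_option autoImplicit false

noncomputable section

open scoped Classical

open NumberField IsDedekindDomain Field
open Literature.NumberTheory.EllipticCurves Literature.NumberTheory.GaloisRepresentations
open Literature.NumberTheory.EllipticCurves.IwasawaDual Literature.NumberTheory.EllipticCurves.AcSigned
open Literature.NumberTheory.EllipticCurves.BertoliniDarmon2005
open Literature.NumberTheory.EllipticCurves.CastellaHsuKunduLeeLiu2025
open WeierstrassCurve (geomTorsion)
open Summit.BirchSwinnertonDyer.BirchSwinnertonDyer.Theorems.SignedBaseChangeAcDivAdmdefUnitLambdaOfLoc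

namespace Summit.BirchSwinnertonDyer.BirchSwinnertonDyer.Theorems.SignedBaseChangeAcDivAdmdefRootVisibleOfUnitLambda

universe u

/-! ## §1 A unit `λ(0)` on a `j = 1` reciprocity line transports non-vanishing at layer `0` from `M` to `x` -/

section LayerZero

variable (p : ℕ) [Fact p.Prime] {U : Type*} [AddCommGroup U]

/-- Bézout at a prime: if `p • u = 0` and `n • u = 0` with `p ∤ n`, then `u = 0`. [folklore] -/
theorem eq_zero_of_nsmul_eq_zero_of_not_dvd {u : U} (hpu : p • u = 0) {n : ℕ} (hnu : n • u = 0) (hn : ¬ p ∣ n) : u = 0 := by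
  have hcop : Nat.Coprime p n := (Nat.Prime.coprime_iff_not_dvd (Fact.out : p.Prime)).mpr hn
  have h1 : ((p : ℤ).gcd (n : ℤ) : ℤ) • u = 0 := by
    rw [Int.gcd_eq_gcd_ab, add_smul, mul_comm, mul_smul, mul_comm, mul_smul]
    rw [natCast_zsmul, natCast_zsmul, hpu, hnu, smul_zero, smul_zero, add_zero]
  rw [Int.gcd_natCast_natCast, hcop, Nat.cast_one, one_smul] at h1
  exact h1

/-- **A UNIT `λ(0)` transports non-vanishing at layer `0` from the line's generator side to `x`.**  If `Λ·x = λ·M`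
(`SpanEqSmul p 1 λ x M`: every `y ∈ M` has `λ·y ∈ Λ·x`), the target `U` is killed by `p`, `λ(0) ∈ ℤ_pˣ`, and some `y ∈ M` has
`y_0(a) ≠ 0`, then `x_0(a) ≠ 0`: at layer `0` the truncated action of `f ∈ Λ` is multiplication by `f(0) mod p`
(`coTsmul_layer_zero_apply`), so `λ·y = f·x` reads `(λ(0) mod p)·y_0(a) = (f(0) mod p)·x_0(a)`, and `λ(0) mod p` is prime to `p`.
[cite: Howard2006, Lem. 3.1.2 and §3.2 (15)] [cite: CastellaEtAl2025, Thm. 7.4 (arXiv:2308.10474v2 p0030 L44–L52)] -/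
theorem layer_zero_ne_zero_of_spanEqSmul_of_isUnit {lam : IwasawaAlgebra p} {x : Π n : ℕ, ZMod (p ^ n) → U}
    {M : (Π n : ℕ, ZMod (p ^ n) → U) → Prop} (h : SpanEqSmul p 1 lam x M) (hU : ∀ u : U, p • u = 0)
    (hlam : IsUnit (PowerSeries.constantCoeff lam)) {y : Π n : ℕ, ZMod (p ^ n) → U} (hy : M y)
    {a : ZMod (p ^ 0)} (hy0 : y 0 a ≠ 0) : x 0 a ≠ 0 := by
  intro hx
  obtain ⟨f, hf⟩ := h.2 y hy
  have hcomp := congrFun (congrFun hf 0) a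
  rw [coTsmul_layer_zero_apply, coTsmul_layer_zero_apply, hx, smul_zero] at hcomp
  -- `(λ(0) mod p).val` is prime to `p`
  have hunit : IsUnit (PadicInt.toZModPow 1 (PowerSeries.constantCoeff lam)) := hlam.map _
  have hval : ¬ p ∣ (PadicInt.toZModPow 1 (PowerSeries.constantCoeff lam)).val := by
    intro hdvd
    have hcop : Nat.Coprime (PadicInt.toZModPow 1 (PowerSeries.constantCoeff lam)).val (p ^ 1) := by
      have h := ZMod.val_coe_unit_coprime hunit.unit
      rwa [IsUnit.unit_spec] at h
    have hcop' : Nat.Coprime (PadicInt.toZModPow 1 (PowerSeries.constantCoeff lam)).val p :=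
      hcop.coprime_dvd_right (dvd_pow_self p one_ne_zero)
    have h1 : p ∣ 1 := by
      have h := Nat.dvd_gcd hdvd (dvd_refl p)
      rwa [Nat.Coprime.gcd_eq_one hcop'] at h
    exact (Fact.out : p.Prime).one_lt.ne' (Nat.dvd_one.mp h1)
  exact hy0 (eq_zero_of_nsmul_eq_zero_of_not_dvd p (hU _) hcomp hval)

end LayerZero

/-! ## §2 The delta family is coinduced -/

section Delta

variable (p : ℕ) [Fact p.Prime] {U : Type*} [AddCommGroup U]

/-- A natural number below the modulus casts to zero only if it is zero. [folklore] -/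
theorem natCast_zmod_eq_zero_iff_of_lt {k m : ℕ} (hm : m < k) : ((m : ℕ) : ZMod k) = 0 ↔ m = 0 := by
  rw [ZMod.natCast_eq_zero_iff]
  constructor
  · intro h
    exact Nat.eq_zero_of_dvd_of_lt h hm
  · rintro rfl; exact dvd_zero k

/-- **The «delta» family `a ↦ [a = 0]·u` is coinduced** (`IsCoinducedIn p ⊤`): for `a ∈ ℤ/pⁿ` the lifts `ã + pⁿ i`, `i < p`, of `a` to
`ℤ/p^{n+1}` are all non-zero unless `a = 0` and `i = 0` (they are `< p^{n+1}`), so `Σ_{i<p} δ_{n+1}(ã + pⁿ i) = δ_n(a)`.  This is the element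
`u ⊗ 1` of `U ⊗ Λ = lim←_n U[Γ/Γ^{pⁿ}]`. [cite: Howard2006, Lem. 3.1.2 (the coinduced module)] -/
theorem isCoinducedIn_delta (u : U) : IsCoinducedIn p (⊤ : AddSubgroup U) (fun _ a ↦ if a = 0 then u else 0) := by
  have hp : p.Prime := Fact.out
  refine ⟨fun _ _ ↦ AddSubgroup.mem_top _, fun n a ↦ ?_⟩
  have hpn : 0 < p ^ n := pow_pos hp.pos n
  have hpn1 : 0 < p ^ (n + 1) := pow_pos hp.pos (n + 1)
  have hlt : ∀ i ∈ Finset.range p, a.val + p ^ n * i < p ^ (n + 1) := fun i hi ↦ by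
    have hi' : i ≤ p - 1 := Nat.le_sub_one_of_lt (Finset.mem_range.mp hi)
    haveI : NeZero (p ^ n) := ⟨hpn.ne'⟩
    calc a.val + p ^ n * i < p ^ n + p ^ n * (p - 1) := by
            have := ZMod.val_lt a
            have h2 : p ^ n * i ≤ p ^ n * (p - 1) := Nat.mul_le_mul_left _ hi'
            omega
      _ = p ^ (n + 1) := by
            rw [pow_succ]
            have h1 : 1 ≤ p := hp.one_lt.le
            zify [h1]
            ring
  have hzero : ∀ i ∈ Finset.range p, (((a.val + p ^ n * i : ℕ) : ZMod (p ^ (n + 1))) = 0 ↔ a = 0 ∧ i = 0) := fun i hi ↦ by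
    haveI : NeZero (p ^ n) := ⟨hpn.ne'⟩
    rw [natCast_zmod_eq_zero_iff_of_lt (hlt i hi)]
    constructor
    · intro h
      have ha : a.val = 0 := by omega
      have hi0 : p ^ n * i = 0 := by omega
      refine ⟨(ZMod.val_eq_zero a).mp ha, ?_⟩
      rcases Nat.mul_eq_zero.mp hi0 with h' | h'
      · exact absurd h' hpn.ne'
      · exact h'
    · rintro ⟨rfl, rfl⟩
      rw [ZMod.val_zero, mul_zero, add_zero]
  show (if a = 0 then u else 0) = ∑ i ∈ Finset.range p, (if ((a.val + p ^ n * i : ℕ) : ZMod (p ^ (n + 1))) = 0 then u else 0)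
  by_cases ha : a = 0
  · -- only `i = 0` contributes
    rw [if_pos ha]
    rw [Finset.sum_eq_single_of_mem 0 (Finset.mem_range.mpr hp.pos) (fun i hi hi0 ↦ by
      rw [if_neg (fun h ↦ hi0 ((hzero i hi).mp h).2)])]
    rw [if_pos ((hzero 0 (Finset.mem_range.mpr hp.pos)).mpr ⟨ha, rfl⟩)]
  · rw [if_neg ha]
    refine (Finset.sum_eq_zero fun i hi ↦ ?_).symm
    rw [if_neg (fun h ↦ ha ((hzero i hi).mp h).1)]

end Delta

/-! ## §3 `H¹(H, E[n])` is killed by `n` -/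

section Torsion

variable {K : Type u} [Field K] (W : WeierstrassCurve K)

/-- **`n · H¹(H, E[n]) = 0`** for every subgroup `H ≤ Γ_K`: a class is represented by a continuous cocycle with values in `E[n]`
(`oneCocycleClass_surjective`), and `n` kills `E[n]` pointwise (as `zsmul_galH1Torsion_eq_zero` for `H = Γ_K`).
[cite: SilvermanAEC2009, X.§4] [cite: SerreGaloisCohomology1997, I.§2.2] -/
theorem zsmul_torsionH1Over_eq_zero (n : ℤ) (H : Subgroup (absoluteGaloisGroup K)) (x : W.torsionH1Over n H) : n • x = 0 := by
  obtain ⟨φ, rfl⟩ := oneCocycleClass_surjective (discreteTopRep H (W.geomTorsion n)) x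
  have hφ : n • φ = 0 := by
    apply Subtype.ext
    ext g
    rw [Submodule.coe_smul, ContinuousMap.smul_apply, Submodule.coe_zero, ContinuousMap.zero_apply]
    have hg : n • ((φ.1 g : W.geomTorsion n) : W.geomPoints) = 0 :=
      (Submodule.mem_torsionBy_iff n _).mp (φ.1 g).2
    rw [AddSubgroupClass.coe_zsmul, ZeroMemClass.coe_zero]
    exact hg
  have h := oneCocycleClass_smul (discreteTopRep H (W.geomTorsion n)) n φ
  rw [hφ, oneCocycleClass_zero] at h
  rw [← int_smul_eq_zsmul (ModuleCat.isModule _)]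
  exact h.symm

/-- `p · H¹(H, E[p]) = 0` (the case `n = p^1`, natural-number scalar). [cite: SilvermanAEC2009, X.§4] -/
theorem nsmul_torsionH1Over_pow_one_eq_zero (p : ℕ) (H : Subgroup (absoluteGaloisGroup K)) (x : W.torsionH1Over ((p : ℤ) ^ 1) H) :
    p • x = 0 := by
  have h := zsmul_torsionH1Over_eq_zero W ((p : ℤ) ^ 1) H x
  rw [congrArg (fun t : ℤ ↦ t • x) (pow_one (p : ℤ)), natCast_zsmul] at h
  exact h

end Torsion

/-! ## §4 The converse root criterion for a signed bipartite system -/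

section Root

variable {K : Type} [Field K] [NumberField K] {W : WeierstrassCurve ℚ} [W.IsGloballyMinimal] {p : ℕ} [Fact p.Prime]
  {κ : ZpExtension K p} {γ : absoluteGaloisGroup K} {N : ℕ} {ε : ℤˣ} {B : SignedBipartiteSystem W K p κ}

/-- **A unit `λ_1(q)(0)` at the definite vertex `{q}` makes the root class VISIBLE at `q`.**  Let `B` be a signed bipartite system of
sign `ε` at level `N` (`IsSignedBipartiteSystem`, CHKLL25 Thm. 7.4 as typed), `q` a `1`-admissible prime, `𝔓 ∣ v ∋ q`, `φ ∈ D_𝔓 ∩ Gal(K̄/K_∞)`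
an arithmetic Frobenius with `H¹(⟨φ⟩, E[p]) ≠ 0` (witness `u`).  If `λ_1(q)(0) ∈ ℤ_pˣ` then `res_{⟨φ⟩}(κ_1(1)_0) ≠ 0`; in particular the
bottom class `κ_1(1)_0 ∈ H¹(K, E[p])` is NON-ZERO.  Second reciprocity law «`loc_q(κ_1(1)) = λ_1(q)` under `H¹_unr(K_q, T_1) ≃ Λ/pΛ`»
(`Λ·unrLoc_φ(κ_1(1)) = λ_1(q)·{coinduced families}`) applied to the delta family of `u`.  Converse of
`…AdmdefUnitLambdaOfLoc.hasUnitLambda_of_root_res_ne_zero`. [cite: CastellaEtAl2025, Thm. 7.4, second law (arXiv:2308.10474v2 p0030 L50–L52)]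
[cite: Howard2006, §3.2 (15), Thm. 3.2.3 (c), §2.3] -/
theorem res_kappa_one_ne_zero_of_isUnit_lam (hB : IsSignedBipartiteSystem W K p κ γ N ε B) {q : ℕ}
    (hq : IsAdmissiblePrime N K (fun ℓ ↦ W.frobeniusTrace ℓ) p 1 q)
    {v : HeightOneSpectrum (𝓞 K)} (hv : ((q : ℕ) : 𝓞 K) ∈ v.asIdeal) {𝔓 : Ideal (absIntegers (𝓞 K) K)}
    (h𝔓 : 𝔓 ∈ v.primesAbove) {φ : absoluteGaloisGroup K} (hφ : φ ∈ κ.kerSubgroup)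
    (hφD : φ ∈ 𝔓.decompositionSubgroup (absoluteGaloisGroup K)) (hφF : IsArithFrobAt (𝓞 K) φ 𝔓)
    (u : (W.baseChange K).torsionH1Over ((p : ℤ) ^ 1) (Subgroup.zpowers φ)) (hu : u ≠ 0)
    (hlam : IsUnit (PowerSeries.constantCoeff (B.lam 1 q))) :
    resOfLe (geomTorsion (W.baseChange K) ((p : ℤ) ^ 1))
      ((Subgroup.zpowers_le.mpr hφ).trans (κ.kerSubgroup_le_layerSubgroup 0)) (B.kappa 1 1 0) ≠ 0 := by
  have hmq : 1 * q ∈ defProducts N K (fun ℓ ↦ W.frobeniusTrace ℓ) p 1 := by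
    rw [one_mul]; exact mem_defProducts_of_isAdmissiblePrime hq
  have hq1 : ¬ q ∣ 1 := fun h ↦ hq.prime.ne_one (Nat.eq_one_of_dvd_one h)
  have hlaw := hB.second_law 1 1 q one_pos hmq hq hq1 v hv 𝔓 h𝔓 φ hφ hφD hφF
  rw [one_mul] at hlaw
  have hx : unrLoc (W.baseChange K) p κ γ 1 hφ (B.kappa 1 1) 0 0 ≠ 0 :=
    layer_zero_ne_zero_of_spanEqSmul_of_isUnit p hlaw
      (fun w ↦ nsmul_torsionH1Over_pow_one_eq_zero (W.baseChange K) p (Subgroup.zpowers φ) w) hlam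
      (isCoinducedIn_delta p u) (by simpa using hu)
  rwa [unrLoc_apply_zero] at hx

/-- **Hence the bottom class itself is non-zero**: `κ_1(1)_0 ≠ 0`. [cite: CastellaEtAl2025, Thm. 7.4 second law] [cite: Howard2006, Thm. 3.2.3 (c)] -/
theorem kappa_one_layer_zero_ne_zero_of_isUnit_lam (hB : IsSignedBipartiteSystem W K p κ γ N ε B) {q : ℕ}
    (hq : IsAdmissiblePrime N K (fun ℓ ↦ W.frobeniusTrace ℓ) p 1 q)
    {v : HeightOneSpectrum (𝓞 K)} (hv : ((q : ℕ) : 𝓞 K) ∈ v.asIdeal) {𝔓 : Ideal (absIntegers (𝓞 K) K)}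
    (h𝔓 : 𝔓 ∈ v.primesAbove) {φ : absoluteGaloisGroup K} (hφ : φ ∈ κ.kerSubgroup)
    (hφD : φ ∈ 𝔓.decompositionSubgroup (absoluteGaloisGroup K)) (hφF : IsArithFrobAt (𝓞 K) φ 𝔓)
    (u : (W.baseChange K).torsionH1Over ((p : ℤ) ^ 1) (Subgroup.zpowers φ)) (hu : u ≠ 0)
    (hlam : IsUnit (PowerSeries.constantCoeff (B.lam 1 q))) : B.kappa 1 1 0 ≠ 0 := by
  intro h0
  apply res_kappa_one_ne_zero_of_isUnit_lam hB hq hv h𝔓 hφ hφD hφF u hu hlam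
  rw [h0, map_zero]

/-- **The same for the limit base class** (`B.IsLimitBaseClass z`: `z_{0,1} = κ_1(1)_0`): a unit `λ_1(q)(0)` at a definite vertex `{q}` whose
Frobenius target `H¹(⟨φ⟩, E[p])` is non-zero forces `z_{0,1} ≠ 0` — the d = 1 research text (RV₁)H of `Lines/admdef.lean` v22 follows from the
rank-0 anchor at ONE such vertex. [cite: CastellaEtAl2025, (7.2), Thm. 7.4 second law] [cite: Howard2006, §3.2 (16), Thm. 3.2.3 (c)] -/
theorem limitBaseClass_layer_zero_one_ne_zero_of_isUnit_lam (hB : IsSignedBipartiteSystem W K p κ γ N ε B)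
    {z : Π n j : ℕ, (W.baseChange K).torsionH1Over ((p : ℤ) ^ j) (κ.layerSubgroup n)} (hz : B.IsLimitBaseClass z) {q : ℕ}
    (hq : IsAdmissiblePrime N K (fun ℓ ↦ W.frobeniusTrace ℓ) p 1 q)
    {v : HeightOneSpectrum (𝓞 K)} (hv : ((q : ℕ) : 𝓞 K) ∈ v.asIdeal) {𝔓 : Ideal (absIntegers (𝓞 K) K)}
    (h𝔓 : 𝔓 ∈ v.primesAbove) {φ : absoluteGaloisGroup K} (hφ : φ ∈ κ.kerSubgroup)
    (hφD : φ ∈ 𝔓.decompositionSubgroup (absoluteGaloisGroup K)) (hφF : IsArithFrobAt (𝓞 K) φ 𝔓)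
    (u : (W.baseChange K).torsionH1Over ((p : ℤ) ^ 1) (Subgroup.zpowers φ)) (hu : u ≠ 0)
    (hlam : IsUnit (PowerSeries.constantCoeff (B.lam 1 q))) : z 0 1 ≠ 0 := by
  rw [hz 0 1 one_pos]
  exact kappa_one_layer_zero_ne_zero_of_isUnit_lam hB hq hv h𝔓 hφ hφD hφF u hu hlam

end Root

end Summit.BirchSwinnertonDyer.BirchSwinnertonDyer.Theorems.SignedBaseChangeAcDivAdmdefRootVisibleOfUnitLambda

end
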